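import Literature.AlgebraicGeometry.Motives.HodgeStructureCentralizerPrimitiveCentralIdempotents
import HarnessLib

/-!
# THE BLOCKS `V_i = e_i V` ALONG `k ⊆ k'`: `φ(e_𝔪) = Σ_{𝔫 above 𝔪} e_𝔫` AND `span_{k'} j(V_i) = φ(e_i)(V ⊗ k') = ⊕_{𝔫 above 𝔪_i} V_𝔫` —
# MILNE'S `V_i ⊗_k k' = ⊕_j V_{ij}` FOR `F_i ⊗_k k' = Π_j F_{ij}` (Milne 1999 §1 Remark 1.6 «`C'(A) ≅ C(A) ⊗_k k'`», §2 p. 646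
# «`F ⊗_ℚ k = F₁ × ⋯ × F_t`, `1 = e₁ + ⋯ + e_t`, `V(A) = V₁ ⊕ ⋯ ⊕ V_t`, `V_i = e_i V = V ⊗_{F ⊗ k} F_i`»)

[topic AlgebraicGeometry/Motives]

Layer `Literature/AlgebraicGeometry/Motives`, lane `lit-hodgefound` (Track 2 foundations library; prover seat
`lit-hodgefound-p02`, generation 56, self-proposed row g56-#9). THEOREMS ONLY: no definition, no named fact (net debt `0`),
no instance, no notation.  Joins g56-#3 (`MaxSpec(Z_L) → MaxSpec(Z_K)` surjective with fibres cut out by `φ(e_𝔪)`; the block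
`e_𝔪(K ⊗ V)` spans `φ(e_𝔪)(L ⊗ V)` over `L`) and g56-#7 (the primitive central idempotents `(e_𝔪)` as a complete orthogonal system,
`K ⊗ V = ⊕_𝔪 e_𝔪(K ⊗ V)`).  PROVED here, for a polarizable `ℚ`-Hodge structure `H` on a finite-dimensional `V`, fields `ℚ ⊆ K ⊆ L`,
any ring homomorphism `φ : Z_K → Z_L` over `j`, and primitive families `(e_𝔪)` of `Z_K`, `(e'_𝔫)` of `Z_L`:
(i) MODULES: for orthogonal idempotent endomorphisms, `(Σ_{i ∈ S} E_i)(M) = ⊔_{i ∈ S} E_i(M)`;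
(ii) ALGEBRA: along an injective ring homomorphism of reduced finite-dimensional commutative algebras,
`φ(e_𝔪) = Σ_{𝔫 | φ⁻¹(𝔫) = 𝔪} e'_𝔫` (`e_i ⊗ 1 = Σ_j e_{ij}`);
(iii) FOR `C(H)`: `φ(e_𝔪) = Σ_{𝔫 above 𝔪} e'_𝔫`, and **`span_L j(e_𝔪(K ⊗ V)) = φ(e_𝔪)(L ⊗ V) = ⊔_{𝔫 above 𝔪} e'_𝔫(L ⊗ V)` with the
`e'_𝔫(L ⊗ V)` independent** — Milne's `V_i ⊗_k k' = ⊕_j V_{ij}`.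

## The sources, verbatim

* J. S. Milne, *Lefschetz classes on abelian varieties*, Duke Math. J. 96 (1999) 639–675 [Milne1999LefschetzClasses] (held
  `paper:doi-10-1215-s0012-7094-99-09620-5`): folio 6 = p. 644 L30–L37 (Remark 1.6 «`C'(A) ≅ C(A) ⊗_k k'`»); folio 8 = p. 646
  L33–L40 «Let `F ⊗_ℚ k = F₁ × ⋯ × F_t` … `1 = e₁ + ⋯ + e_t` … `V(A) = V₁ ⊕ ⋯ ⊕ V_t`, `V_i = e_i V = V ⊗_{F ⊗_ℚ k} F_i`. … Any
  `k`-linear map `α : V → V` commuting with the action of `F` decomposes into `α = α₁ ⊕ ⋯ ⊕ α_t`».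
* R. S. Pierce, *Associative Algebras*, GTM 88 (1982) [Pierce1982], §10.7 Cor. b; T. Y. Lam, *A First Course in Noncommutative
  Rings* [Lam2001FirstCourse], §23 proof of Thm. (23.8).
* N. Bourbaki, *Algebra I* [BourbakiAlgebraI1989], Ch. II §7 no. 7 (extension of scalars of a direct sum).

Nearest tree results, BY NAME: g56-#3 `comap_eq_iff_map_notMem`, `range_map_eq_span_image_extendScalars`,
`comap_maximalSpectrum_center_centralizer_surjective`; g56-#7 `eq_sum_primitiveIdempotents_of_isIdempotentElem`,
`completeOrthogonalIdempotents_primitive_central_idempotents`, `isInternal_range_primitive_central_idempotents`; Mathlib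
`OrthogonalIdempotents.mul_eq`, `Submodule.sum_mem_biSup`, `DirectSum.IsInternal.submodule_iSupIndep`, `iSupIndep.comp`.

## Dictionary and what is proved

`j = extendScalars K L V`, `Z_K = Subalgebra.center K C(H)(K)`, "`φ` over `j`" = `∀ z x, (φ z).1.1 (j x) = j (z.1.1 x)`, "`(e_𝔪)`
primitive" = `∀ 𝔪, IsIdempotentElem (e 𝔪) ∧ e 𝔪 ∉ 𝔪 ∧ ∀ 𝔪' ≠ 𝔪, e 𝔪 ∈ 𝔪'`; the fibre over `𝔪` is any Finset `S'` with
`𝔫 ∈ S' ↔ φ⁻¹(𝔫) = 𝔪`.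

* §1 (namespace `…Motives`) **`range_sum_eq_biSup_range_of_orthogonalIdempotents`**.
* §2 (namespace `…Motives.HodgeStructure`) **`map_primitiveIdempotent_eq_sum`** (`φ(e_𝔪) = Σ_{fibre} e'_𝔫`, abstract).
* §3 **`map_primitive_central_idempotent_eq_sum`**, **`span_image_extendScalars_range_primitive_central_idempotent_eq_biSup`**
  (`span_L j(e_𝔪(K ⊗ V)) = φ(e_𝔪)(L ⊗ V) = ⊔_{fibre} e'_𝔫(L ⊗ V)`, independent).
-/

noncomputable section

open scoped TensorProduct

namespace Literature.AlgebraicGeometry.Motives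

universe u u' v

/-! ## §1 Modules: the range of a sum of orthogonal idempotent endomorphisms is the join of their ranges -/

section Module

/-- **`(Σ_{i ∈ S} E_i)(M) = ⊔_{i ∈ S} E_i(M)` FOR ORTHOGONAL IDEMPOTENT ENDOMORPHISMS** (`E_i E_j = δ_{ij} E_i`): `⊆` termwise, `⊇` since
`(Σ_j E_j)(E_i x) = E_i x`. [cite: Lam2001FirstCourse, §23 proof of Thm. (23.8)] -/
theorem range_sum_eq_biSup_range_of_orthogonalIdempotents {R : Type*} [Ring R] {M : Type*} [AddCommGroup M] [Module R M]
    {ι : Type*} {E : ι → Module.End R M} (hE : OrthogonalIdempotents E) (S : Finset ι) :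
    LinearMap.range (∑ i ∈ S, E i) = ⨆ i ∈ S, LinearMap.range (E i) := by
  classical
  refine le_antisymm ?_ (iSup₂_le fun i hi => ?_)
  · rintro _ ⟨x, rfl⟩
    rw [LinearMap.sum_apply]
    exact Submodule.sum_mem_biSup fun i _ => LinearMap.mem_range_self (E i) x
  · rintro _ ⟨x, rfl⟩
    refine ⟨E i x, ?_⟩
    rw [LinearMap.sum_apply, Finset.sum_eq_single_of_mem i hi (fun j _ hji => ?_)]
    · rw [← Module.End.mul_apply, (hE.idem i).eq]
    · rw [← Module.End.mul_apply, hE.mul_eq, if_neg hji, LinearMap.zero_apply]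

end Module

namespace HodgeStructure

/-! ## §2 Algebra: along an injective `φ : Z → Z'`, `φ(e_𝔪) = Σ_{𝔫 above 𝔪} e'_𝔫` -/

section Algebra

/-- **`φ(e_𝔪) = Σ_{𝔫 | φ⁻¹(𝔫) = 𝔪} e'_𝔫`**: the image of a primitive idempotent of `Z` is the sum of the primitive idempotents of `Z'` in
the fibre over `𝔪` (`φ(e_𝔪)` is an idempotent of `Z'` and `φ(e_𝔪) ∉ 𝔫 ⟺ φ⁻¹(𝔫) = 𝔪`, g56-#3 ∕ g56-#7) — `e_i ⊗ 1 = Σ_j e_{ij}` for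
`F_i ⊗_k k' = Π_j F_{ij}`. [cite: Milne1999LefschetzClasses, §1 Remark 1.6 (p. 644) and §2 p. 646 L33–L36] [cite: Pierce1982, §10.7 Cor. b] -/
theorem map_primitiveIdempotent_eq_sum (K : Type u) [Field K] {Z : Type*} [CommRing Z] [Algebra K Z] [Module.Finite K Z]
    [IsReduced Z] (K' : Type u') [Field K'] {Z' : Type*} [CommRing Z'] [Algebra K' Z'] [Module.Finite K' Z'] [IsReduced Z']
    (φ : Z →+* Z') {e : MaximalSpectrum Z → Z}
    (he : ∀ I, IsIdempotentElem (e I) ∧ e I ∉ I.asIdeal ∧ ∀ J : MaximalSpectrum Z, J ≠ I → e I ∈ J.asIdeal)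
    {e' : MaximalSpectrum Z' → Z'}
    (he' : ∀ I', IsIdempotentElem (e' I') ∧ e' I' ∉ I'.asIdeal ∧ ∀ J' : MaximalSpectrum Z', J' ≠ I' → e' I' ∈ J'.asIdeal)
    (I : MaximalSpectrum Z) (S' : Finset (MaximalSpectrum Z')) (hS' : ∀ I', I' ∈ S' ↔ I'.asIdeal.comap φ = I.asIdeal) :
    φ (e I) = ∑ I' ∈ S', e' I' := by
  refine eq_sum_primitiveIdempotents_of_isIdempotentElem K' he' ((he I).1.map φ) S' fun I' => ?_
  rw [hS' I', ← comap_eq_iff_map_notMem K Z φ I I' (he I).2.1 (he I).2.2]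
  constructor
  · intro h
    exact MaximalSpectrum.ext h
  · intro h
    exact congrArg MaximalSpectrum.asIdeal h

end Algebra

/-! ## §3 The blocks along `K → L`: `span_L j(e_𝔪(K ⊗ V)) = φ(e_𝔪)(L ⊗ V) = ⊕_{𝔫 above 𝔪} e_𝔫(L ⊗ V)` -/

section Blocks

variable (K : Type u) (L : Type u') [Field K] [Field L] [Algebra ℚ K] [Algebra ℚ L] [Algebra K L]
  [IsScalarTower ℚ K L] {V : Type v} [AddCommGroup V] [Module ℚ V] [Module.Finite ℚ V] {n : ℤ} (H : HodgeStructure V n)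

set_option maxSynthPendingDepth 4 in
/-- The standing instance on `Z_K`: finite-dimensional over `K`. [folklore] -/
private theorem finite_center_centralizer₅₆₉ :
    Module.Finite K (Subalgebra.center K (Subalgebra.centralizer K
      ((fun a : Module.End ℚ V => a.baseChange K) '' (H.endAlg : Set (Module.End ℚ V))))) := by
  haveI := finite_centralizer_endAlg_baseChange K H
  haveI : IsNoetherian K (Subalgebra.centralizer K
      ((fun a : Module.End ℚ V => a.baseChange K) '' (H.endAlg : Set (Module.End ℚ V)))) :=
    isNoetherian_of_isNoetherianRing_of_finite K _
  exact Module.Finite.of_injective (Subalgebra.val _).toLinearMap Subtype.val_injective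

set_option maxSynthPendingDepth 4 in
omit [Algebra K L] [IsScalarTower ℚ K L] in
/-- **`φ(e_𝔪) = Σ_{𝔫 above 𝔪} e_𝔫` FOR THE PRIMITIVE CENTRAL IDEMPOTENTS OF `C(H)(K)` AND `C(H)(L)`** along a ring homomorphism
`φ : Z_K → Z_L` over `j` (polarizable `H`; `S'` = the fibre over `𝔪`, nonempty by g56-#3). [cite: Milne1999LefschetzClasses, §1 Remark 1.6 (p. 644) and §2 p. 646 L33–L36]
[cite: Pierce1982, §10.7 Cor. b] -/
theorem map_primitive_central_idempotent_eq_sum (hH : H.IsPolarizable)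
    (φ : Subalgebra.center K (Subalgebra.centralizer K
        ((fun a : Module.End ℚ V => a.baseChange K) '' (H.endAlg : Set (Module.End ℚ V)))) →+*
      Subalgebra.center L (Subalgebra.centralizer L
        ((fun a : Module.End ℚ V => a.baseChange L) '' (H.endAlg : Set (Module.End ℚ V)))))
    {e : MaximalSpectrum (Subalgebra.center K (Subalgebra.centralizer K
          ((fun a : Module.End ℚ V => a.baseChange K) '' (H.endAlg : Set (Module.End ℚ V))))) →
        Subalgebra.center K (Subalgebra.centralizer K
          ((fun a : Module.End ℚ V => a.baseChange K) '' (H.endAlg : Set (Module.End ℚ V))))}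
    (he : ∀ I, IsIdempotentElem (e I) ∧ e I ∉ I.asIdeal ∧ ∀ J, J ≠ I → e I ∈ J.asIdeal)
    {e' : MaximalSpectrum (Subalgebra.center L (Subalgebra.centralizer L
          ((fun a : Module.End ℚ V => a.baseChange L) '' (H.endAlg : Set (Module.End ℚ V))))) →
        Subalgebra.center L (Subalgebra.centralizer L
          ((fun a : Module.End ℚ V => a.baseChange L) '' (H.endAlg : Set (Module.End ℚ V))))}
    (he' : ∀ I', IsIdempotentElem (e' I') ∧ e' I' ∉ I'.asIdeal ∧ ∀ J', J' ≠ I' → e' I' ∈ J'.asIdeal)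
    (I : MaximalSpectrum (Subalgebra.center K (Subalgebra.centralizer K
          ((fun a : Module.End ℚ V => a.baseChange K) '' (H.endAlg : Set (Module.End ℚ V))))))
    (S' : Finset (MaximalSpectrum (Subalgebra.center L (Subalgebra.centralizer L
          ((fun a : Module.End ℚ V => a.baseChange L) '' (H.endAlg : Set (Module.End ℚ V)))))))
    (hS' : ∀ I', I' ∈ S' ↔ I'.asIdeal.comap φ = I.asIdeal) :
    φ (e I) = ∑ I' ∈ S', e' I' := by
  haveI := finite_center_centralizer₅₆₉ K H
  haveI := finite_center_centralizer₅₆₉ L H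
  haveI := isReduced_center_centralizer_endAlg_baseChange K hH
  haveI := isReduced_center_centralizer_endAlg_baseChange L hH
  exact map_primitiveIdempotent_eq_sum K L φ he he' I S' hS'

set_option maxSynthPendingDepth 4 in
/-- **MILNE'S `V_i ⊗_k k' = ⊕_j V_{ij}`: `span_L j(e_𝔪(K ⊗ V)) = φ(e_𝔪)(L ⊗ V) = ⊔_{𝔫 above 𝔪} e_𝔫(L ⊗ V)`, THE JOIN BEING DIRECT** (polarizable
`H`, `φ` over `j`; the blocks `e_𝔫(L ⊗ V)` are independent, g56-#7 `K ⊗ V = ⊕ e_𝔪(K ⊗ V)` over `L`).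
[cite: Milne1999LefschetzClasses, §1 Remark 1.6 (p. 644) and §2 p. 646 L33–L40 (`V_i = e_i V = V ⊗_{F ⊗ k} F_i`)] [cite: Lam2001FirstCourse, §23 proof of Thm. (23.8)] -/
theorem span_image_extendScalars_range_primitive_central_idempotent_eq_biSup (hH : H.IsPolarizable)
    [Fintype (MaximalSpectrum (Subalgebra.center L (Subalgebra.centralizer L
      ((fun a : Module.End ℚ V => a.baseChange L) '' (H.endAlg : Set (Module.End ℚ V))))))]
    [DecidableEq (MaximalSpectrum (Subalgebra.center L (Subalgebra.centralizer L
      ((fun a : Module.End ℚ V => a.baseChange L) '' (H.endAlg : Set (Module.End ℚ V))))))]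
    (φ : Subalgebra.center K (Subalgebra.centralizer K
        ((fun a : Module.End ℚ V => a.baseChange K) '' (H.endAlg : Set (Module.End ℚ V)))) →+*
      Subalgebra.center L (Subalgebra.centralizer L
        ((fun a : Module.End ℚ V => a.baseChange L) '' (H.endAlg : Set (Module.End ℚ V)))))
    (hφ : ∀ z x, ((φ z).1.1 : Module.End L (L ⊗[ℚ] V)) (extendScalars K L V x) =
      extendScalars K L V ((z.1.1 : Module.End K (K ⊗[ℚ] V)) x))
    {e : MaximalSpectrum (Subalgebra.center K (Subalgebra.centralizer K
          ((fun a : Module.End ℚ V => a.baseChange K) '' (H.endAlg : Set (Module.End ℚ V))))) →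
        Subalgebra.center K (Subalgebra.centralizer K
          ((fun a : Module.End ℚ V => a.baseChange K) '' (H.endAlg : Set (Module.End ℚ V))))}
    (he : ∀ I, IsIdempotentElem (e I) ∧ e I ∉ I.asIdeal ∧ ∀ J, J ≠ I → e I ∈ J.asIdeal)
    {e' : MaximalSpectrum (Subalgebra.center L (Subalgebra.centralizer L
          ((fun a : Module.End ℚ V => a.baseChange L) '' (H.endAlg : Set (Module.End ℚ V))))) →
        Subalgebra.center L (Subalgebra.centralizer L
          ((fun a : Module.End ℚ V => a.baseChange L) '' (H.endAlg : Set (Module.End ℚ V))))}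
    (he' : ∀ I', IsIdempotentElem (e' I') ∧ e' I' ∉ I'.asIdeal ∧ ∀ J', J' ≠ I' → e' I' ∈ J'.asIdeal)
    (I : MaximalSpectrum (Subalgebra.center K (Subalgebra.centralizer K
          ((fun a : Module.End ℚ V => a.baseChange K) '' (H.endAlg : Set (Module.End ℚ V))))))
    (S' : Finset (MaximalSpectrum (Subalgebra.center L (Subalgebra.centralizer L
          ((fun a : Module.End ℚ V => a.baseChange L) '' (H.endAlg : Set (Module.End ℚ V)))))))
    (hS' : ∀ I', I' ∈ S' ↔ I'.asIdeal.comap φ = I.asIdeal) :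
    Submodule.span L (extendScalars K L V '' (LinearMap.range ((e I).1.1 : Module.End K (K ⊗[ℚ] V)) : Set (K ⊗[ℚ] V))) =
        LinearMap.range ((φ (e I)).1.1 : Module.End L (L ⊗[ℚ] V)) ∧
      LinearMap.range ((φ (e I)).1.1 : Module.End L (L ⊗[ℚ] V)) =
        ⨆ I' ∈ S', LinearMap.range ((e' I').1.1 : Module.End L (L ⊗[ℚ] V)) ∧
      iSupIndep fun I' : S' => LinearMap.range ((e' (I' : MaximalSpectrum _)).1.1 : Module.End L (L ⊗[ℚ] V)) := by
  have hsum := map_primitive_central_idempotent_eq_sum K L H hH φ he he' I S' hS'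
  have hortho := (completeOrthogonalIdempotents_primitive_central_idempotents L hH he').2
  refine ⟨((range_map_eq_span_image_extendScalars K L H φ hφ (e I)).1).symm, ?_, ?_⟩
  · rw [hsum]
    have hcoe : ((∑ I' ∈ S', e' I').1.1 : Module.End L (L ⊗[ℚ] V)) = ∑ I' ∈ S', ((e' I').1.1 : Module.End L (L ⊗[ℚ] V)) := by
      rw [← Subalgebra.val_apply, ← Subalgebra.val_apply, ← AlgHom.comp_apply, map_sum]
      rfl
    rw [hcoe]
    exact range_sum_eq_biSup_range_of_orthogonalIdempotents hortho.toOrthogonalIdempotents S'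
  · exact (isInternal_range_primitive_central_idempotents L hH he').submodule_iSupIndep.comp Subtype.val_injective

end Blocks

end HodgeStructure

end Literature.AlgebraicGeometry.Motives
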